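import Literature.Topology.FourManifolds.LeftHandDiscRetractionFlow
import Literature.Topology.FourManifolds.RegularSlabLevelFlow
import Literature.Topology.FourManifolds.MilnorModelTrajectories
import HarnessLib

/-!
# Milnor 1965, proof of Thm. 3.14: the stages above and below the Morse chart
# (pushing down from `V'`, and the product `V × [a, a']` with the tube about `S_L`)

Topic `Literature/Topology/FourManifolds` (fact seat
`provefact-Literature.Topology.FourManifolds.Cobordism.Milnor1965_deformationRetract_leftHandDiscs`:
stages 0 and 3 of the strong deformation retraction assembled in `HCobordismLevelConnectivityProofs.lean`;
stages 1 and 2 are `LeftHandDiscRetractionFlow.lean` and `LeftHandDiscRetractionBox.lean`).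
Everything here is **proved**.

Milnor, *Lectures on the h-cobordism theorem* (1965), proof of Thm. 3.14 (PDF pp. 19–20 of the
held copy `lit read book:milnornd-lectures-h-cobordism-theorem`) writes the two retractions in the
model `ω(V, φ_L) ≅ W` of Thm. 3.13, whose coordinates `(x⃗, y⃗)` on `L_λ` reach down to `V`:
the cylinder `C = {|y⃗| ≤ 1/10}` has its base on `V`, and Case 2 of the second retraction
(`1 ≤ |x⃗|² ≤ 1 + 1/100`) moves the thin collar of `C` beside `S_L` down to `V`.  The tree's
Morse chart (a Milnor box) need not reach the level `V = f⁻¹(a)` of the fact; so the cylinder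
is cut at a level `a' = c₀ - r²` inside the box (`LeftHandDiscRetractionBox.lean`,
`LeftHandDiscRetractionFlow.lean`), and the region `f⁻¹[a, a']` between the two levels — a
product `V' × [a, a']` along the trajectories by Thm. 3.4 (PDF p. 12), proof of Thm. 3.13
(PDF p. 19: *"we know from 3.4 that `f⁻¹[c₀, c - ε²]` [is a] product cobordism"*) — is
retracted here, in the product coordinates given by a *level flow*
(`Literature.Topology.FourManifolds.IsLevelFlow`, `RegularSlabLevelFlow.lean`) and the tube
`V' ∩ C_i ≅ S^{λ-1} × D_η` about each left-hand sphere `S_L(ctr i) ⊂ V'`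
(`MilnorBox.basePt`), the tube that Milnor's characteristic embedding `φ_L` of Def. 3.9
parametrises:

* §1 the model retraction of the square `[0, 1]² ∋ (ρ, h)` (radius in the tube, height in the
  product) onto its bottom and left edges, `sqRetr₁`, `sqRetr₂` — follow the direction
  `(-(1 - ρ), -1)`: the identity on the two edges, vertical on the right edge `ρ = 1` (so that it
  glues with the vertical push outside the tube), continuous; and the interpolations `newRad`,
  `newHgt` at stage `t`;
* §2 **stage 0** (`pushDown`, `pushDown_spec`): pushing `f⁻¹[a, b]` down onto `f⁻¹[a, b₂]`
  along a level flow of the critical-point-free slab `f⁻¹[b₂, b]` (Milnor's use of Thm. 3.4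
  for `f⁻¹[c + ε², c₁]`);
* §3 **stage 3** in the setting `Cobordism.FirstRetractionSetting` with a level flow `ψ` on
  `f⁻¹[a, a']` (`ThirdRetractionHyp`): the tube map `tubeMap` (in the coordinates
  `(v, s) = (ψ z a', f z)` and `(ρ, y⃗)` of `v ∈ V' ∩ C_i`: scale `y⃗` by `newRad/ρ`, keeping the
  point on the base, and go to the height `newHgt`), the vertical push `vertMap` off the tubes,
  and the pasted `retr₃` (identity above `V'`, where after stage 2 only the discs `D_i` are
  left); pointwise behaviour (`tubeMap_zero`, `tubeMap_one_mem` — at `t = 1` on the bottom level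
  or, through a point of the left-hand sphere, on the left-hand disc; fixes the bottom level and
  the left-hand discs; equals the vertical push on the tube boundary), joint continuity
  (`continuousOn_tubeMap`: at the left-hand sphere the factor `newRad/ρ` is discontinuous but
  bounded and `y⃗ → 0`), and **`retr₃_spec`** — stage 3 packaged: a homotopy of
  `f⁻¹[a, a'] ∪ ⋃ D_i` in itself from the identity to a map into `f⁻¹(a) ∪ ⋃ D_L(ctr i, a)`,
  fixing that set (closed cover by the tube pieces, the vertical piece and the disc piece).

## References

* J. Milnor, *Lectures on the h-cobordism theorem*, notes by L. Siebenmann and J. Sondow,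
  Princeton Mathematical Notes (1965): Def. 3.9 (PDF p. 16), Thm. 3.4 (PDF p. 12), proofs of
  Thms. 3.13–3.14 and Remark (PDF pp. 19–21).  Held:
  `lit read book:milnornd-lectures-h-cobordism-theorem`. [MilnorHCobordism1965]
-/

open scoped Manifold ContDiff Topology
open Set Function Filter

noncomputable section

namespace Literature.Topology.FourManifolds

open Flow

universe u

/-! ### §1 The model retraction of the square `[0, 1]²` onto its bottom and left edges -/

section Square

/-- First coordinate of the model retraction of the `(ρ, h)`-square onto `{h = 0} ∪ {ρ = 0}`
(new radius): follow the direction `(-(1 - ρ), -1)` until an edge is hit. [folklore] -/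
def sqRetr₁ (ρ h : ℝ) : ℝ := max (ρ - h * (1 - ρ)) 0

/-- Second coordinate of the model retraction (new height). [folklore] -/
def sqRetr₂ (ρ h : ℝ) : ℝ := max (h * (1 - ρ) - ρ) 0 / max (1 - ρ) (1 / 2)

/-- `sqRetr₁` is continuous. [folklore] -/
theorem continuous_sqRetr₁ : Continuous fun p : ℝ × ℝ => sqRetr₁ p.1 p.2 := by
  unfold sqRetr₁; fun_prop

/-- `sqRetr₂` is continuous (the denominator is `≥ 1/2`). [folklore] -/
theorem continuous_sqRetr₂ : Continuous fun p : ℝ × ℝ => sqRetr₂ p.1 p.2 := by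
  unfold sqRetr₂
  refine Continuous.div (by fun_prop) (by fun_prop) fun p => ?_
  exact (lt_of_lt_of_le (by norm_num) (le_max_right _ _)).ne'

variable {ρ h : ℝ}

/-- `0 ≤ sqRetr₁ ≤ ρ` for `h ≥ 0`, `ρ ≤ 1`. [folklore] -/
theorem sqRetr₁_mem (hρ : ρ ∈ Icc (0 : ℝ) 1) (hh : 0 ≤ h) : sqRetr₁ ρ h ∈ Icc 0 ρ := by
  unfold sqRetr₁
  refine ⟨le_max_right _ _, max_le ?_ hρ.1⟩
  nlinarith [hρ.2]

/-- `0 ≤ sqRetr₂ ≤ h` for `ρ ∈ [0, 1]`, `h ≥ 0`. [folklore] -/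
theorem sqRetr₂_mem (hρ : ρ ∈ Icc (0 : ℝ) 1) (hh : 0 ≤ h) : sqRetr₂ ρ h ∈ Icc 0 h := by
  unfold sqRetr₂
  have hden : 0 < max (1 - ρ) (1 / 2) := lt_of_lt_of_le (by norm_num) (le_max_right _ _)
  refine ⟨div_nonneg (le_max_right _ _) hden.le, ?_⟩
  rw [div_le_iff₀ hden]
  refine max_le ?_ (by positivity)
  have : h * (1 - ρ) ≤ h * max (1 - ρ) (1 / 2) := mul_le_mul_of_nonneg_left (le_max_left _ _) hh
  linarith [hρ.1]

/-- **The model retraction lands on the edges**: one of the two coordinates vanishes. [folklore] -/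
theorem sqRetr₁_eq_zero_or : sqRetr₁ ρ h = 0 ∨ sqRetr₂ ρ h = 0 := by
  unfold sqRetr₁ sqRetr₂
  by_cases h1 : ρ - h * (1 - ρ) ≤ 0
  · exact Or.inl (max_eq_right h1)
  · right
    rw [max_eq_right (by linarith), zero_div]

/-- On the right edge `ρ = 1`: `(1, 0)` (the tube boundary goes straight down). [folklore] -/
theorem sqRetr_one (h : ℝ) : sqRetr₁ 1 h = 1 ∧ sqRetr₂ 1 h = 0 := by
  unfold sqRetr₁ sqRetr₂; constructor <;> simp

/-- On the bottom edge `h = 0`: the identity `(ρ, 0)` (for `ρ ≥ 0`). [folklore] -/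
theorem sqRetr_of_h_zero (hρ : 0 ≤ ρ) : sqRetr₁ ρ 0 = ρ ∧ sqRetr₂ ρ 0 = 0 := by
  unfold sqRetr₁ sqRetr₂
  refine ⟨by simp [hρ], ?_⟩
  rw [zero_mul, zero_sub, max_eq_right (by linarith), zero_div]

/-- On the left edge `ρ = 0`: the identity `(0, h)` (for `h ≥ 0`). [folklore] -/
theorem sqRetr_of_ρ_zero (hh : 0 ≤ h) : sqRetr₁ 0 h = 0 ∧ sqRetr₂ 0 h = h := by
  unfold sqRetr₁ sqRetr₂
  refine ⟨by simp [hh], ?_⟩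
  rw [sub_zero, sub_zero, mul_one, max_eq_left hh, max_eq_left (by norm_num), div_one]

/-- The new radius at stage `t`: `(1 - t) ρ + t · sqRetr₁ ρ h`. [folklore] -/
def newRad (t ρ hg : ℝ) : ℝ := (1 - t) * ρ + t * sqRetr₁ ρ hg

/-- The new height at stage `t`: `(1 - t) h + t · sqRetr₂ ρ h`. [folklore] -/
def newHgt (t ρ hg : ℝ) : ℝ := (1 - t) * hg + t * sqRetr₂ ρ hg

/-- `newRad ∈ [0, ρ]`. [folklore] -/
theorem newRad_mem {t ρ hg : ℝ} (ht : t ∈ Icc (0 : ℝ) 1) (hρ : ρ ∈ Icc (0 : ℝ) 1) (hh : 0 ≤ hg) :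
    newRad t ρ hg ∈ Icc 0 ρ := by
  obtain ⟨h1, h2⟩ := sqRetr₁_mem hρ hh
  unfold newRad; constructor <;> nlinarith [ht.1, ht.2, hρ.1]

/-- `newHgt ∈ [0, hg]`. [folklore] -/
theorem newHgt_mem {t ρ hg : ℝ} (ht : t ∈ Icc (0 : ℝ) 1) (hρ : ρ ∈ Icc (0 : ℝ) 1) (hh : 0 ≤ hg) :
    newHgt t ρ hg ∈ Icc 0 hg := by
  obtain ⟨h1, h2⟩ := sqRetr₂_mem hρ hh
  unfold newHgt; constructor <;> nlinarith [ht.1, ht.2]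


end Square

/-! ### §2 Stage 0: pushing a slab down onto a lower slab along a level flow -/

section VerticalPush

variable {n : ℕ} {W : Type*} [TopologicalSpace W] [ChartedSpace (EuclideanHalfSpace (n + 1)) W]
  {f : W → ℝ} {ξ : Π x : W, TangentSpace (𝓡∂ (n + 1)) x} {b₂ b : ℝ} {ψ : W → ℝ → W}

/-- **Pushing `f⁻¹[a, b]` down onto `f⁻¹[a, b₂]`** along a level flow `ψ` of the slab
`f⁻¹[b₂, b]` without critical values: a point above `b₂` moves down its trajectory to the
interpolated level `f z - t (f z - b₂)`, the points below stay (Milnor: `f⁻¹[c + ε², c₁]` is a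
product cobordism, Thm. 3.4, first paragraph of the proof of Thm. 3.13). [cite: MilnorHCobordism1965, Thm. 3.4 (PDF p. 12), proof of Thm. 3.13 (PDF p. 19)] -/
def pushDown (f : W → ℝ) (ψ : W → ℝ → W) (b₂ t : ℝ) (z : W) : W :=
  if f z ≤ b₂ then z else ψ z (f z - t * (f z - b₂))

/-- **Stage 0, packaged.**  For a level flow on `f⁻¹[b₂, b]` and `a ≤ b₂ ≤ b`: the maps
`pushDown t` are jointly continuous on `[0, 1] × f⁻¹[a, b]`, map the slab into itself, start at
the identity, end in `f⁻¹[a, b₂]`, and fix `f⁻¹[a, b₂]` pointwise. [cite: MilnorHCobordism1965, Thm. 3.4 (PDF p. 12), proof of Thm. 3.13 (PDF p. 19)] -/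
theorem pushDown_spec (hψ : IsLevelFlow n f ξ b₂ b ψ) (hfc : Continuous f) {a : ℝ} (ha : a ≤ b₂) :
    ContinuousOn (fun p : ℝ × W => pushDown f ψ b₂ p.1 p.2) (Icc (0 : ℝ) 1 ×ˢ (f ⁻¹' Icc a b)) ∧
      (∀ t ∈ Icc (0 : ℝ) 1, MapsTo (pushDown f ψ b₂ t) (f ⁻¹' Icc a b) (f ⁻¹' Icc a b)) ∧
      (∀ z ∈ f ⁻¹' Icc a b, pushDown f ψ b₂ 0 z = z) ∧
      (∀ z ∈ f ⁻¹' Icc a b, pushDown f ψ b₂ 1 z ∈ f ⁻¹' Icc a b₂) ∧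
      (∀ t ∈ Icc (0 : ℝ) 1, ∀ z ∈ f ⁻¹' Icc a b, z ∈ f ⁻¹' Icc a b₂ → pushDown f ψ b₂ t z = z) := by
  -- the target level of a point above `b₂`
  have hlev : ∀ t ∈ Icc (0 : ℝ) 1, ∀ z, b₂ ≤ f z → f z ≤ b → f z - t * (f z - b₂) ∈ Icc b₂ b := by
    intro t ht z h1 h2; constructor <;> nlinarith [ht.1, ht.2]
  have hval : ∀ t ∈ Icc (0 : ℝ) 1, ∀ z, b₂ ≤ f z → f z ≤ b →
      pushDown f ψ b₂ t z = ψ z (f z - t * (f z - b₂)) := by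
    intro t ht z h1 h2
    by_cases hle : f z ≤ b₂
    · have heq : f z = b₂ := le_antisymm hle h1
      rw [pushDown, if_pos hle, heq, sub_self, mul_zero, sub_zero, ← heq, hψ.eq_self z ⟨h1, h2⟩]
    · rw [pushDown, if_neg hle]
  have hid : ∀ t z, f z ≤ b₂ → pushDown f ψ b₂ t z = z := fun t z hz => if_pos hz
  refine ⟨?_, ?_, ?_, ?_, ?_⟩
  · -- continuity: paste `{f ≤ b₂}` (identity) and `{b₂ ≤ f}` (the flow formula)
    have hA : IsClosed (Icc (0 : ℝ) 1 ×ˢ (f ⁻¹' Icc a b) ∩ {p : ℝ × W | f p.2 ≤ b₂}) :=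
      (isClosed_Icc.prod (isClosed_Icc.preimage hfc)).inter (isClosed_le (hfc.comp continuous_snd) continuous_const)
    have hB : IsClosed (Icc (0 : ℝ) 1 ×ˢ (f ⁻¹' Icc a b) ∩ {p : ℝ × W | b₂ ≤ f p.2}) :=
      (isClosed_Icc.prod (isClosed_Icc.preimage hfc)).inter (isClosed_le continuous_const (hfc.comp continuous_snd))
    have h1 : ContinuousOn (fun p : ℝ × W => pushDown f ψ b₂ p.1 p.2)
        (Icc (0 : ℝ) 1 ×ˢ (f ⁻¹' Icc a b) ∩ {p | f p.2 ≤ b₂}) :=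
      continuousOn_snd.congr fun p hp => hid p.1 p.2 hp.2
    have h2 : ContinuousOn (fun p : ℝ × W => pushDown f ψ b₂ p.1 p.2)
        (Icc (0 : ℝ) 1 ×ˢ (f ⁻¹' Icc a b) ∩ {p | b₂ ≤ f p.2}) := by
      have hin : ContinuousOn (fun p : ℝ × W => (p.2, f p.2 - p.1 * (f p.2 - b₂)))
          (Icc (0 : ℝ) 1 ×ˢ (f ⁻¹' Icc a b) ∩ {p | b₂ ≤ f p.2}) := by
        refine Continuous.continuousOn ?_
        fun_prop
      have := hψ.continuousOn.comp hin fun p hp => ⟨⟨hp.2, hp.1.2.2⟩, hlev p.1 hp.1.1 p.2 hp.2 hp.1.2.2⟩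
      exact this.congr fun p hp => hval p.1 hp.1.1 p.2 hp.2 hp.1.2.2
    have := h1.union_of_isClosed h2 hA hB
    refine this.mono fun p hp => ?_
    rcases le_total (f p.2) b₂ with h | h
    · exact Or.inl ⟨hp, h⟩
    · exact Or.inr ⟨hp, h⟩
  · intro t ht z hz
    rcases le_total (f z) b₂ with h | h
    · rw [hid t z h]; exact hz
    · rw [hval t ht z h hz.2, mem_preimage, hψ.apply_eq z ⟨h, hz.2⟩ _ (hlev t ht z h hz.2)]
      exact ⟨ha.trans (hlev t ht z h hz.2).1, (hlev t ht z h hz.2).2⟩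
  · intro z hz
    rcases le_total (f z) b₂ with h | h
    · exact hid 0 z h
    · rw [hval 0 ⟨le_rfl, zero_le_one⟩ z h hz.2, zero_mul, sub_zero, hψ.eq_self z ⟨h, hz.2⟩]
  · intro z hz
    rcases le_total (f z) b₂ with h | h
    · rw [hid 1 z h]; exact ⟨hz.1, h⟩
    · rw [hval 1 ⟨zero_le_one, le_rfl⟩ z h hz.2, mem_preimage,
        hψ.apply_eq z ⟨h, hz.2⟩ _ (hlev 1 ⟨zero_le_one, le_rfl⟩ z h hz.2)]
      constructor <;> linarith
  · intro t _ z _ hz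
    exact hid t z hz.2

end VerticalPush

/-! ### §3 Stage 3: below the box — the product `V × [a, a']` and the tube about `S_L` -/

section Model2

variable {m : ℕ}

/-- `gePart` is idempotent. [folklore] -/
theorem gePart_gePart (k : ℕ) (v : EuclideanSpace ℝ (Fin m)) : gePart k (gePart k v) = gePart k v := by
  ext i; simp only [gePart_apply]; split_ifs <;> rfl

/-- `|y⃗(y⃗(v))|² = |y⃗(v)|²`. [folklore] -/
theorem sqSumGE_gePart (k : ℕ) (v : EuclideanSpace ℝ (Fin m)) : sqSumGE k (gePart k v) = sqSumGE k v := by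
  simp only [sqSumGE]
  refine Finset.sum_congr rfl fun i hi => ?_
  rw [Finset.mem_filter] at hi
  simp [not_lt.2 hi.2]

/-- `y⃗(c • v) = c • y⃗(v)`. [folklore] -/
theorem gePart_smul (k : ℕ) (c : ℝ) (v : EuclideanSpace ℝ (Fin m)) : gePart k (c • v) = c • gePart k v := by
  ext i; simp only [gePart_apply, PiLp.smul_apply, smul_eq_mul]; split_ifs <;> simp

end Model2

section ThirdRetraction

variable {n : ℕ} {M N : Type u} [TopologicalSpace M] [ChartedSpace (EuclideanSpace ℝ (Fin n)) M]
  [TopologicalSpace N] [ChartedSpace (EuclideanSpace ℝ (Fin n)) N]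

namespace Cobordism

namespace FirstRetractionSetting

variable {c : Cobordism n M N} {f : c.W → ℝ} {ξ : Π x : c.W, TangentSpace (𝓡∂ (n + 1)) x}
  {ℓ₀ ℓ₁ a' b₂ c₀ r η : ℝ} {θ : ℝ × c.W → c.W} {ι : Type*} {ctr : ι → c.W}
  {D : ∀ i, MilnorBox (𝓡∂ (n + 1)) f (slabField f ξ ℓ₀ ℓ₁) (ctr i)}
  (h : FirstRetractionSetting c f ξ ℓ₀ ℓ₁ a' b₂ c₀ r η θ ctr D)
  {a : ℝ} {ψ : c.W → ℝ → c.W}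

/-- The radius coordinate `ρ = |y⃗|/η` of a point of the box `i`. [folklore] -/
def rad (_h : FirstRetractionSetting c f ξ ℓ₀ ℓ₁ a' b₂ c₀ r η θ ctr D) (i : ι) (w : c.W) : ℝ :=
  Real.sqrt (sqSumGE (D i).k ((D i).coord w)) / η

/-- The height coordinate `h = (f z - a)/(a' - a)` of a point of `f⁻¹[a, a']`. [folklore] -/
def hgt (_h : FirstRetractionSetting c f ξ ℓ₀ ℓ₁ a' b₂ c₀ r η θ ctr D) (a : ℝ) (z : c.W) : ℝ :=
  (f z - a) / (a' - a)

/-- **The tube map of stage 3** about the left-hand sphere of the centre `i`: in the coordinates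
`(v, s) = (ψ z a', f z)` of the product `f⁻¹[a, a'] ≅ V × [a, a']` and the tube coordinates
`(ρ, y⃗)` of `v ∈ V ∩ C_i`, move `(ρ, h)` by the model retraction of the square: scale `y⃗(v)` by
`newRad/ρ` (keeping the point on the base, `MilnorBox.basePt`) and go to the height `newHgt`. [cite: MilnorHCobordism1965, proof of Thm. 3.14 (PDF pp. 19–20) with Def. 3.9 (PDF p. 16) and Thm. 3.4 (PDF p. 12)] -/
def tubeMap (h : FirstRetractionSetting c f ξ ℓ₀ ℓ₁ a' b₂ c₀ r η θ ctr D) (a : ℝ) (ψ : c.W → ℝ → c.W)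
    (i : ι) (t : ℝ) (z : c.W) : c.W :=
  ψ ((D i).basePt r (ψ z a')
      ((newRad t (h.rad i (ψ z a')) (h.hgt a z) / h.rad i (ψ z a')) • gePart (D i).k ((D i).coord (ψ z a'))))
    (a + newHgt t (h.rad i (ψ z a')) (h.hgt a z) * (a' - a))

/-- **The vertical push of stage 3** off the tubes: `z ↦ ψ z (a + (1 - t)(f z - a))`. [cite: MilnorHCobordism1965, Thm. 3.4 (PDF p. 12)] -/
def vertMap (_h : FirstRetractionSetting c f ξ ℓ₀ ℓ₁ a' b₂ c₀ r η θ ctr D) (a : ℝ) (ψ : c.W → ℝ → c.W)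
    (t : ℝ) (z : c.W) : c.W :=
  ψ z (a + (1 - t) * (f z - a))

/-- **Stage 3**: the tube map over the tubes, the vertical push off them, the identity above `V`
(there only the discs `D_i` are left after stage 2). [cite: MilnorHCobordism1965, proof of Thm. 3.14 (PDF pp. 19–20)] -/
def retr₃ (h : FirstRetractionSetting c f ξ ℓ₀ ℓ₁ a' b₂ c₀ r η θ ctr D) (a : ℝ) (ψ : c.W → ℝ → c.W)
    (t : ℝ) (z : c.W) : c.W := by
  classical
  exact if f z ≤ a' then
    (if hT : ∃ i, ψ z a' ∈ (D i).cylBase r η then h.tubeMap a ψ hT.choose t z else h.vertMap a ψ t z)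
    else z

/-- **The hypotheses of stage 3** on top of the setting of the first retraction: a level flow
`ψ` on the slab `f⁻¹[a, a']` below the box (`a < a'`), which contains no critical value. [cite: MilnorHCobordism1965, Thm. 3.4 (PDF p. 12), Lemma 2.9 (PDF p. 11)] -/
structure ThirdRetractionHyp (h : FirstRetractionSetting c f ξ ℓ₀ ℓ₁ a' b₂ c₀ r η θ ctr D) (a : ℝ)
    (ψ : c.W → ℝ → c.W) : Prop where
  /-- the level flow below the box -/
  levelFlow : IsLevelFlow n f ξ a a' ψ
  /-- the slab below the box is non-degenerate -/
  lt : a < a'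
  /-- and contains no critical value -/
  regular : ∀ z, IsMCriticalPt (𝓡∂ (n + 1)) f z → f z ∉ Icc a a'

section Pointwise

/-- `basePt` only sees the expanding part of its vector argument. [folklore] -/
theorem basePt_gePart' (i : ι) (v : c.W) (y : EuclideanSpace ℝ (Fin (n + 1))) :
    (D i).basePt r v (gePart (D i).k y) = (D i).basePt r v y := by
  simp only [MilnorBox.basePt, gePart_gePart, sqSumGE_gePart]

/-- The level of the vertical push lies in `[a, a']`. [folklore] -/
theorem vert_level_mem {z : c.W} (hz : f z ∈ Icc a a') {t : ℝ} (ht : t ∈ Icc (0 : ℝ) 1) :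
    a + (1 - t) * (f z - a) ∈ Icc a a' := by
  constructor <;> nlinarith [ht.1, ht.2, hz.1, hz.2]

include h

/-- The flow-line identity of `ψ`, with the smoothness hypotheses filled in from the setting. [cite: MilnorHCobordism1965, proof of Thm. 3.4 (PDF pp. 12–13)] -/
theorem psi_apply_apply (H : h.ThirdRetractionHyp a ψ) {x : c.W} (hx : f x ∈ Icc a a') {s t : ℝ}
    (hs : s ∈ Icc a a') (ht : t ∈ Icc a a') : ψ (ψ x s) t = ψ x t :=
  H.levelFlow.apply_apply h.slab.contMDiff h.slab.mdifferentiable_f h.slab.mlineDeriv_pos H.regular hx hs ht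

/-- The top projection `ψ z a'` of a point of `f⁻¹[a, a']` lies on `V`. [folklore] -/
theorem apply_top (H : h.ThirdRetractionHyp a ψ) {z : c.W} (hz : f z ∈ Icc a a') : f (ψ z a') = a' :=
  H.levelFlow.apply_eq z hz a' ⟨H.lt.le, le_rfl⟩

/-- The top projection lies in `f⁻¹[a, a']`. [folklore] -/
theorem top_mem (H : h.ThirdRetractionHyp a ψ) {z : c.W} (hz : f z ∈ Icc a a') : f (ψ z a') ∈ Icc a a' := by
  rw [h.apply_top H hz]; exact ⟨H.lt.le, le_rfl⟩

/-- The height of a point of `f⁻¹[a, a']` lies in `[0, 1]`, and `a + h (a' - a) = f z`. [folklore] -/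
theorem hgt_mem (haa : a < a') {z : c.W} (hz : f z ∈ Icc a a') :
    h.hgt a z ∈ Icc (0 : ℝ) 1 ∧ a + h.hgt a z * (a' - a) = f z := by
  have hd : 0 < a' - a := sub_pos.2 haa
  refine ⟨⟨div_nonneg (sub_nonneg.2 hz.1) hd.le, (div_le_one hd).2 (by linarith [hz.2])⟩, ?_⟩
  rw [hgt, div_mul_cancel₀ _ hd.ne']; ring

/-- `h = 0` on the bottom level. [folklore] -/
theorem hgt_eq_zero {z : c.W} (hz : f z = a) : h.hgt a z = 0 := by
  rw [hgt, hz, sub_self, zero_div]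

/-- `h = 1` on `V`. [folklore] -/
theorem hgt_eq_one (haa : a < a') {z : c.W} (hz : f z = a') : h.hgt a z = 1 := by
  rw [hgt, hz, div_self (sub_pos.2 haa).ne']

/-- The radius of a point of the base lies in `[0, 1]` and `(ρ η)² = |y⃗|²`. [folklore] -/
theorem rad_mem {i : ι} {w : c.W} (hw : w ∈ (D i).cylBase r η) :
    h.rad i w ∈ Icc (0 : ℝ) 1 ∧ (h.rad i w * η) ^ 2 = sqSumGE (D i).k ((D i).coord w) := by
  have hη := h.η_pos
  have hB := hw.1.2.1
  have hBnn := sqSumGE_nonneg (D i).k ((D i).coord w)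
  refine ⟨⟨div_nonneg (Real.sqrt_nonneg _) hη.le, ?_⟩, ?_⟩
  · rw [rad, div_le_one hη]
    calc Real.sqrt (sqSumGE (D i).k ((D i).coord w)) ≤ Real.sqrt (η ^ 2) := Real.sqrt_le_sqrt hB
      _ = η := Real.sqrt_sq hη.le
  · rw [rad, div_mul_cancel₀ _ hη.ne', Real.sq_sqrt hBnn]

/-- `ρ = 0` iff `y⃗ = 0`. [folklore] -/
theorem rad_eq_zero_iff {i : ι} {w : c.W} (hw : w ∈ (D i).cylBase r η) :
    h.rad i w = 0 ↔ sqSumGE (D i).k ((D i).coord w) = 0 := by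
  rw [← (h.rad_mem hw).2]
  constructor
  · intro h0; rw [h0, zero_mul, zero_pow two_ne_zero]
  · intro h0
    have := pow_eq_zero_iff two_ne_zero |>.1 h0
    rcases mul_eq_zero.1 this with h1 | h1
    · exact h1
    · exact absurd h1 h.η_pos.ne'

/-- `ρ = 1` when `|y⃗|² = η²` (the boundary of the tube). [folklore] -/
theorem rad_eq_one_of {i : ι} {w : c.W} (hB : sqSumGE (D i).k ((D i).coord w) = η ^ 2) : h.rad i w = 1 := by
  rw [rad, hB, Real.sqrt_sq h.η_pos.le, div_self h.η_pos.ne']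

/-! #### The scaled expanding part and the new base point -/

/-- `|y⃗'|²` of the scaled expanding part `y⃗' = (newRad/ρ) y⃗(w)` is `(newRad · η)²` (also when
`ρ = 0`, both sides vanishing), hence `≤ |y⃗(w)|² ≤ η²`. [folklore] -/
theorem sqSumGE_yvec {i : ι} {w : c.W} (hw : w ∈ (D i).cylBase r η) {t : ℝ} (ht : t ∈ Icc (0 : ℝ) 1)
    {hg : ℝ} (hhg : 0 ≤ hg) :
    sqSumGE (D i).k ((newRad t (h.rad i w) hg / h.rad i w) • gePart (D i).k ((D i).coord w)) =
      (newRad t (h.rad i w) hg * η) ^ 2 ∧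
    sqSumGE (D i).k ((newRad t (h.rad i w) hg / h.rad i w) • gePart (D i).k ((D i).coord w)) ≤
      sqSumGE (D i).k ((D i).coord w) ∧
    sqSumGE (D i).k ((newRad t (h.rad i w) hg / h.rad i w) • gePart (D i).k ((D i).coord w)) ≤ η ^ 2 := by
  obtain ⟨hρ, hρη⟩ := h.rad_mem hw
  have hnr := newRad_mem ht hρ hhg
  have hB := hw.1.2.1
  rw [sqSumGE_smul, sqSumGE_gePart]
  have key : (newRad t (h.rad i w) hg / h.rad i w) ^ 2 * sqSumGE (D i).k ((D i).coord w) =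
      (newRad t (h.rad i w) hg * η) ^ 2 := by
    rcases eq_or_lt_of_le hρ.1 with h0 | hpos
    · have hn0 : newRad t (h.rad i w) hg = 0 := le_antisymm (by rw [h0]; exact hnr.2) hnr.1
      rw [hn0, zero_div, zero_mul, zero_pow two_ne_zero, zero_mul]
    · rw [← hρη]; field_simp
  refine ⟨key, ?_, ?_⟩
  · rw [key, ← hρη]
    exact pow_le_pow_left₀ (mul_nonneg hnr.1 h.η_pos.le) (mul_le_mul_of_nonneg_right hnr.2 h.η_pos.le) 2
  · rw [key]
    calc (newRad t (h.rad i w) hg * η) ^ 2 ≤ (1 * η) ^ 2 :=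
          pow_le_pow_left₀ (mul_nonneg hnr.1 h.η_pos.le)
            (mul_le_mul_of_nonneg_right (hnr.2.trans hρ.2) h.η_pos.le) 2
      _ = η ^ 2 := by rw [one_mul]

/-- `|newRad/ρ| ≤ 1`. [folklore] -/
theorem abs_yFactor_le {i : ι} {w : c.W} (hw : w ∈ (D i).cylBase r η) {t : ℝ} (ht : t ∈ Icc (0 : ℝ) 1)
    {hg : ℝ} (hhg : 0 ≤ hg) : |newRad t (h.rad i w) hg / h.rad i w| ≤ 1 := by
  obtain ⟨hρ, -⟩ := h.rad_mem hw
  have hnr := newRad_mem ht hρ hhg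
  rcases eq_or_lt_of_le hρ.1 with h0 | hpos
  · rw [← h0, div_zero, abs_zero]; exact zero_le_one
  · rw [abs_div, abs_of_nonneg hnr.1, abs_of_pos hpos, div_le_one hpos]; exact hnr.2

/-- **The new base point** `v' = basePt r w y⃗'` of the tube map: it lies on the base of the
cylinder `i` with `|y⃗(v')|² = (newRad · η)²`, on the level `V`. [folklore] -/
theorem basePt_yvec_mem {i : ι} {w : c.W} (hw : w ∈ (D i).cylBase r η) {t : ℝ} (ht : t ∈ Icc (0 : ℝ) 1)
    {hg : ℝ} (hhg : 0 ≤ hg) :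
    (D i).basePt r w ((newRad t (h.rad i w) hg / h.rad i w) • gePart (D i).k ((D i).coord w)) ∈ (D i).cylBase r η ∧
    sqSumGE (D i).k ((D i).coord ((D i).basePt r w
      ((newRad t (h.rad i w) hg / h.rad i w) • gePart (D i).k ((D i).coord w)))) = (newRad t (h.rad i w) hg * η) ^ 2 ∧
    f ((D i).basePt r w ((newRad t (h.rad i w) hg / h.rad i w) • gePart (D i).k ((D i).coord w))) = a' := by
  obtain ⟨hsq, -, hle⟩ := h.sqSumGE_yvec hw ht hhg
  obtain ⟨hmem, hB⟩ := MilnorBox.basePt_mem_cylBase (h.sq_le i) h.r_pos hw hle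
  refine ⟨hmem, by rw [hB, hsq], ?_⟩
  rw [MilnorBox.apply_basePt (h.sq_le i) h.r_pos hw hle, h.apply_ctr i, ← h.a'_eq]

/-- With factor `1` (i.e. `newRad = ρ`) the new base point is `w` itself. [folklore] -/
theorem basePt_yvec_eq_self_of_eq {i : ι} {w : c.W} (hw : w ∈ (D i).cylBase r η) {t : ℝ} (ht : t ∈ Icc (0 : ℝ) 1)
    {hg : ℝ} (hhg : 0 ≤ hg) (heq : newRad t (h.rad i w) hg = h.rad i w) :
    (D i).basePt r w ((newRad t (h.rad i w) hg / h.rad i w) • gePart (D i).k ((D i).coord w)) = w := by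
  obtain ⟨hρ, -⟩ := h.rad_mem hw
  rcases eq_or_lt_of_le hρ.1 with h0 | hpos
  · -- `y⃗(w) = 0`
    have hB0 : sqSumGE (D i).k ((D i).coord w) = 0 := (h.rad_eq_zero_iff hw).1 h0.symm
    refine MilnorBox.basePt_eq_self_of_sqSumGE_eq_zero h.r_pos hw hB0 ?_
    rw [(h.sqSumGE_yvec hw ht hhg).1, heq, ← h0, zero_mul, zero_pow two_ne_zero]
  · rw [heq, div_self hpos.ne', one_smul, basePt_gePart' (D := D) i, MilnorBox.basePt_self h.r_pos hw]

/-- With `newRad = 0` the new base point lies on the left-hand sphere of the centre `i`. [cite: MilnorHCobordism1965, Def. 3.9 (PDF p. 16)] -/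
theorem basePt_yvec_mem_leftHandSphere {i : ι} {w : c.W} (hw : w ∈ (D i).cylBase r η) {t : ℝ}
    (ht : t ∈ Icc (0 : ℝ) 1) {hg : ℝ} (hhg : 0 ≤ hg) (h0 : newRad t (h.rad i w) hg = 0) :
    (D i).basePt r w ((newRad t (h.rad i w) hg / h.rad i w) • gePart (D i).k ((D i).coord w)) ∈
      leftHandSphere (𝓡∂ (n + 1)) f ξ (ctr i) a' := by
  obtain ⟨hmem, hB, -⟩ := h.basePt_yvec_mem hw ht hhg
  rw [h.mem_leftHandSphere_ctr_iff]
  exact ⟨hmem, by rw [hB, h0, zero_mul, zero_pow two_ne_zero]⟩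

/-! #### Values of the tube map -/

/-- The level of the tube map lies in `[a, a']`. [folklore] -/
theorem tube_level_mem (H : h.ThirdRetractionHyp a ψ) {z : c.W} (hz : f z ∈ Icc a a') {t : ℝ} (ht : t ∈ Icc (0 : ℝ) 1)
    {ρ : ℝ} (hρ : ρ ∈ Icc (0 : ℝ) 1) : a + newHgt t ρ (h.hgt a z) * (a' - a) ∈ Icc a a' := by
  obtain ⟨hhg, -⟩ := h.hgt_mem H.lt hz
  have hnh := newHgt_mem ht hρ hhg.1
  have hd : 0 < a' - a := sub_pos.2 H.lt
  constructor <;> nlinarith [hnh.1, hnh.2, hhg.2]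

/-- **The tube map lands in `f⁻¹[a, a']`**, at the height `newHgt`. [folklore] -/
theorem apply_tubeMap (H : h.ThirdRetractionHyp a ψ) {i : ι} {z : c.W} (hz : f z ∈ Icc a a')
    (hw : ψ z a' ∈ (D i).cylBase r η) {t : ℝ} (ht : t ∈ Icc (0 : ℝ) 1) :
    f (h.tubeMap a ψ i t z) = a + newHgt t (h.rad i (ψ z a')) (h.hgt a z) * (a' - a) ∧
      f (h.tubeMap a ψ i t z) ∈ Icc a a' := by
  obtain ⟨hhg, -⟩ := h.hgt_mem H.lt hz
  obtain ⟨-, -, hfv⟩ := h.basePt_yvec_mem hw ht hhg.1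
  have hlev := h.tube_level_mem H hz ht (h.rad_mem hw).1
  have := H.levelFlow.apply_eq _ (by rw [hfv]; exact ⟨H.lt.le, le_rfl⟩) _ hlev
  exact ⟨this, by rw [tubeMap, this]; exact hlev⟩

/-- `tubeMap 0 = id`. [folklore] -/
theorem tubeMap_zero (H : h.ThirdRetractionHyp a ψ) {i : ι} {z : c.W} (hz : f z ∈ Icc a a')
    (hw : ψ z a' ∈ (D i).cylBase r η) : h.tubeMap a ψ i 0 z = z := by
  obtain ⟨hhg, hlev⟩ := h.hgt_mem H.lt hz
  have h0 : (0 : ℝ) ∈ Icc (0 : ℝ) 1 := ⟨le_rfl, zero_le_one⟩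
  have hrad : newRad 0 (h.rad i (ψ z a')) (h.hgt a z) = h.rad i (ψ z a') := by simp [newRad]
  have hhgt : newHgt 0 (h.rad i (ψ z a')) (h.hgt a z) = h.hgt a z := by simp [newHgt]
  rw [tubeMap, h.basePt_yvec_eq_self_of_eq hw h0 hhg.1 hrad, hhgt, hlev,
    h.psi_apply_apply H hz ⟨H.lt.le, le_rfl⟩ hz, H.levelFlow.eq_self z hz]

/-- **At `t = 1` the tube map lands in the target** `f⁻¹(a) ∪ D_L(ctr i)`: the model
retraction has put the point on the bottom edge (`f = a`) or on the left edge (`y⃗ = 0`: the new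
base point is on the left-hand sphere, and the point below it on its trajectory is on the
left-hand disc). [cite: MilnorHCobordism1965, proof of Thm. 3.14 (PDF pp. 19–20), Def. 3.9 (PDF p. 16)] -/
theorem tubeMap_one_mem (H : h.ThirdRetractionHyp a ψ) {i : ι} {z : c.W} (hz : f z ∈ Icc a a')
    (hw : ψ z a' ∈ (D i).cylBase r η) :
    h.tubeMap a ψ i 1 z ∈ f ⁻¹' {a} ∪ leftHandDisc (𝓡∂ (n + 1)) f ξ (ctr i) a := by
  have h1 : (1 : ℝ) ∈ Icc (0 : ℝ) 1 := ⟨zero_le_one, le_rfl⟩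
  obtain ⟨hhg, -⟩ := h.hgt_mem H.lt hz
  have hrad : newRad 1 (h.rad i (ψ z a')) (h.hgt a z) = sqRetr₁ (h.rad i (ψ z a')) (h.hgt a z) := by simp [newRad]
  have hhgt : newHgt 1 (h.rad i (ψ z a')) (h.hgt a z) = sqRetr₂ (h.rad i (ψ z a')) (h.hgt a z) := by simp [newHgt]
  obtain ⟨hval, hmem⟩ := h.apply_tubeMap H hz hw h1
  rcases sqRetr₁_eq_zero_or (ρ := h.rad i (ψ z a')) (h := h.hgt a z) with h0 | h0
  · -- left edge: on the left-hand disc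
    right
    have hsph := h.basePt_yvec_mem_leftHandSphere hw h1 hhg.1 (hrad.trans h0)
    rw [Literature.Topology.FourManifolds.mem_leftHandSphere_iff] at hsph
    obtain ⟨hst, hfv⟩ := hsph
    refine ⟨FlowsTo.mem_stableSet ?_ hst, hmem.1⟩
    rw [tubeMap]
    refine H.levelFlow.flowsTo_of_le _ (by rw [hfv]; exact ⟨H.lt.le, le_rfl⟩) _
      (h.tube_level_mem H hz h1 (h.rad_mem hw).1) ?_
    rw [hfv]; exact (h.tube_level_mem H hz h1 (h.rad_mem hw).1).2
  · -- bottom edge: on the level `a`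
    left
    rw [mem_preimage, mem_singleton_iff, hval, hhgt, h0, zero_mul, add_zero]

/-- **The tube map fixes the bottom level.** [folklore] -/
theorem tubeMap_eq_self_of_apply_eq (H : h.ThirdRetractionHyp a ψ) {i : ι} {z : c.W} (hz : f z = a)
    (hw : ψ z a' ∈ (D i).cylBase r η) {t : ℝ} (ht : t ∈ Icc (0 : ℝ) 1) : h.tubeMap a ψ i t z = z := by
  have hzI : f z ∈ Icc a a' := by rw [hz]; exact ⟨le_rfl, H.lt.le⟩
  have hg0 : h.hgt a z = 0 := h.hgt_eq_zero hz
  obtain ⟨hρ, -⟩ := h.rad_mem hw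
  obtain ⟨hr1, hr2⟩ := sqRetr_of_h_zero (ρ := h.rad i (ψ z a')) hρ.1
  have hrad : newRad t (h.rad i (ψ z a')) (h.hgt a z) = h.rad i (ψ z a') := by rw [hg0, newRad, hr1]; ring
  have hhgt : newHgt t (h.rad i (ψ z a')) (h.hgt a z) = 0 := by rw [hg0, newHgt, hr2]; ring
  have haI : a ∈ Icc a a' := ⟨le_rfl, H.lt.le⟩
  rw [tubeMap, h.basePt_yvec_eq_self_of_eq hw ht (by rw [hg0]) hrad, hhgt, zero_mul, add_zero,
    h.psi_apply_apply H hzI ⟨H.lt.le, le_rfl⟩ haI]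
  conv_rhs => rw [← H.levelFlow.eq_self z hzI, hz]

/-- **The tube map fixes the left-hand discs**: a point of `f⁻¹[a, a']` on a trajectory going to
`ctr i` has its top projection on the left-hand sphere, `ρ = 0`, and the model retraction fixes
the left edge. [cite: MilnorHCobordism1965, Def. 3.9 (PDF p. 16)] -/
theorem tubeMap_eq_self_of_mem_stableSet (H : h.ThirdRetractionHyp a ψ) {i : ι} {z : c.W} (hz : f z ∈ Icc a a')
    (hst : z ∈ stableSet (𝓡∂ (n + 1)) ξ (ctr i)) {j : ι} (hw : ψ z a' ∈ (D j).cylBase r η) {t : ℝ}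
    (ht : t ∈ Icc (0 : ℝ) 1) : h.tubeMap a ψ j t z = z := by
  -- the top projection lies on the left-hand sphere of `ctr i`, hence `j = i` and `ρ = 0`
  have hwst : ψ z a' ∈ stableSet (𝓡∂ (n + 1)) ξ (ctr i) :=
    (H.levelFlow.flowsTo_of_ge z hz a' ⟨H.lt.le, le_rfl⟩ hz.2).mem_stableSet_right h.slab.contMDiff_one hst
  have hsph : ψ z a' ∈ leftHandSphere (𝓡∂ (n + 1)) f ξ (ctr i) a' := ⟨hwst, h.apply_top H hz⟩
  rw [h.mem_leftHandSphere_ctr_iff] at hsph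
  obtain ⟨hwi, hB0⟩ := hsph
  have hji : j = i := by
    by_contra hne
    exact (h.disjoint hne).le_bot ⟨hw.1.1, hwi.1.1⟩
  subst hji
  obtain ⟨hhg, hlev⟩ := h.hgt_mem H.lt hz
  have hρ0 : h.rad j (ψ z a') = 0 := (h.rad_eq_zero_iff hw).2 hB0
  obtain ⟨hr1, hr2⟩ := sqRetr_of_ρ_zero (h := h.hgt a z) hhg.1
  have hrad : newRad t (h.rad j (ψ z a')) (h.hgt a z) = h.rad j (ψ z a') := by rw [hρ0, newRad, hr1]; ring
  have hhgt : newHgt t (h.rad j (ψ z a')) (h.hgt a z) = h.hgt a z := by rw [hρ0, newHgt, hr2]; ring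
  rw [tubeMap, h.basePt_yvec_eq_self_of_eq hw ht hhg.1 hrad, hhgt, hlev,
    h.psi_apply_apply H hz ⟨H.lt.le, le_rfl⟩ hz, H.levelFlow.eq_self z hz]

/-- **On the boundary of the tube (`ρ = 1`) the tube map is the vertical push.** [folklore] -/
theorem tubeMap_eq_vertMap (H : h.ThirdRetractionHyp a ψ) {i : ι} {z : c.W} (hz : f z ∈ Icc a a')
    (hw : ψ z a' ∈ (D i).cylBase r η) (hB : sqSumGE (D i).k ((D i).coord (ψ z a')) = η ^ 2) {t : ℝ}
    (ht : t ∈ Icc (0 : ℝ) 1) : h.tubeMap a ψ i t z = h.vertMap a ψ t z := by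
  have hρ1 : h.rad i (ψ z a') = 1 := h.rad_eq_one_of hB
  obtain ⟨hhg, hlev⟩ := h.hgt_mem H.lt hz
  obtain ⟨hr1, hr2⟩ := sqRetr_one (h.hgt a z)
  have hrad : newRad t (h.rad i (ψ z a')) (h.hgt a z) = h.rad i (ψ z a') := by rw [hρ1, newRad, hr1]; ring
  have hhgt : newHgt t (h.rad i (ψ z a')) (h.hgt a z) = (1 - t) * h.hgt a z := by rw [hρ1, newHgt, hr2]; ring
  have hlev' : a + (1 - t) * h.hgt a z * (a' - a) = a + (1 - t) * (f z - a) := by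
    rw [hgt, mul_assoc, div_mul_cancel₀ _ (sub_pos.2 H.lt).ne']
  have hlevI : a + (1 - t) * (f z - a) ∈ Icc a a' := by
    constructor <;> nlinarith [ht.1, ht.2, hz.1, hz.2]
  rw [tubeMap, h.basePt_yvec_eq_self_of_eq hw ht hhg.1 hrad, hhgt, hlev', vertMap,
    h.psi_apply_apply H hz ⟨H.lt.le, le_rfl⟩ hlevI]

/-! #### Values of the vertical push -/

/-- The vertical push lands in `f⁻¹[a, a']`. [folklore] -/
theorem apply_vertMap (H : h.ThirdRetractionHyp a ψ) {z : c.W} (hz : f z ∈ Icc a a') {t : ℝ} (ht : t ∈ Icc (0 : ℝ) 1) :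
    f (h.vertMap a ψ t z) = a + (1 - t) * (f z - a) ∧ f (h.vertMap a ψ t z) ∈ Icc a a' := by
  have := H.levelFlow.apply_eq z hz _ (vert_level_mem (a' := a') hz ht)
  exact ⟨this, by rw [vertMap, this]; exact vert_level_mem (a' := a') hz ht⟩

/-- `vertMap 0 = id`. [folklore] -/
theorem vertMap_zero (H : h.ThirdRetractionHyp a ψ) {z : c.W} (hz : f z ∈ Icc a a') : h.vertMap a ψ 0 z = z := by
  rw [vertMap, sub_zero, one_mul, add_sub_cancel, H.levelFlow.eq_self z hz]

/-- `vertMap 1` lands on the bottom level. [folklore] -/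
theorem vertMap_one (H : h.ThirdRetractionHyp a ψ) {z : c.W} (hz : f z ∈ Icc a a') : f (h.vertMap a ψ 1 z) = a := by
  rw [(h.apply_vertMap H hz ⟨zero_le_one, le_rfl⟩).1]; ring

/-- The vertical push fixes the bottom level. [folklore] -/
theorem vertMap_eq_self_of_apply_eq (H : h.ThirdRetractionHyp a ψ) {z : c.W} (hz : f z = a) (t : ℝ) :
    h.vertMap a ψ t z = z := by
  have hzI : f z ∈ Icc a a' := by rw [hz]; exact ⟨le_rfl, H.lt.le⟩
  rw [vertMap, hz, sub_self, mul_zero, add_zero]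
  conv_rhs => rw [← H.levelFlow.eq_self z hzI, hz]

end Pointwise

section Assembly

include h

/-! #### Which branch: tube or vertical -/

/-- A point of the open set `O = ⋃ {source_i, |y⃗|² < η²}` lying on `V` is in the tube `V ∩ C_i`. [folklore] -/
theorem mem_cylBase_of_core {i : ι} {w : c.W} (hw : w ∈ (D i).chart.source)
    (hB : sqSumGE (D i).k ((D i).coord w) < η ^ 2) (hfw : f w = a') : w ∈ (D i).cylBase r η := by
  have hf := (D i).apply_eq_of_mem_source hw
  rw [hfw, h.apply_ctr i, h.a'_eq] at hf
  have hA : sqSumLT (D i).k ((D i).coord w) = r ^ 2 + sqSumGE (D i).k ((D i).coord w) := by linarith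
  exact ⟨⟨hw, hB.le, hA.le⟩, hA⟩

/-- **Dichotomy for a point of `f⁻¹[a, a']`**: its top projection lies in some tube `V ∩ C_i`, or
outside the open set `O` (where the vertical push is used). [folklore] -/
theorem exists_mem_cylBase_or (H : h.ThirdRetractionHyp a ψ) {z : c.W} (hz : f z ∈ Icc a a') :
    (∃ i, ψ z a' ∈ (D i).cylBase r η) ∨
      ∀ i, ψ z a' ∈ (D i).chart.source → η ^ 2 ≤ sqSumGE (D i).k ((D i).coord (ψ z a')) := by
  by_cases hex : ∃ i, ψ z a' ∈ (D i).cylBase r η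
  · exact Or.inl hex
  · refine Or.inr fun i hsrc => not_lt.1 fun hB => hex ⟨i, h.mem_cylBase_of_core hsrc hB (h.apply_top H hz)⟩

/-- On the tube piece of the box `i`, `retr₃` is the tube map of `i`. [folklore] -/
theorem retr₃_eq_tubeMap {i : ι} {z : c.W} (hz : f z ∈ Icc a a') (hw : ψ z a' ∈ (D i).cylBase r η) (t : ℝ) :
    h.retr₃ a ψ t z = h.tubeMap a ψ i t z := by
  classical
  have hex : ∃ j, ψ z a' ∈ (D j).cylBase r η := ⟨i, hw⟩
  have hji : hex.choose = i := by
    by_contra hne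
    exact (h.disjoint hne).le_bot ⟨hex.choose_spec.1.1, hw.1.1⟩
  simp only [retr₃, if_pos hz.2, dif_pos hex]
  rw [hji]

/-- Off the open set `O`, `retr₃` is the vertical push. [folklore] -/
theorem retr₃_eq_vertMap (H : h.ThirdRetractionHyp a ψ) {z : c.W} (hz : f z ∈ Icc a a')
    (hO : ∀ i, ψ z a' ∈ (D i).chart.source → η ^ 2 ≤ sqSumGE (D i).k ((D i).coord (ψ z a')))
    {t : ℝ} (ht : t ∈ Icc (0 : ℝ) 1) : h.retr₃ a ψ t z = h.vertMap a ψ t z := by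
  classical
  by_cases hex : ∃ j, ψ z a' ∈ (D j).cylBase r η
  · obtain ⟨j, hj⟩ := hex
    rw [h.retr₃_eq_tubeMap hz hj t]
    exact h.tubeMap_eq_vertMap H hz hj (le_antisymm hj.1.2.1 (hO j hj.1.1)) ht
  · simp only [retr₃, if_pos hz.2, dif_neg hex]

/-- Above `V` (in particular on the discs `D_i` off `V`), `retr₃` is the identity. [folklore] -/
theorem retr₃_eq_self_of_lt {z : c.W} (hz : a' < f z) (t : ℝ) : h.retr₃ a ψ t z = z := by
  classical
  simp only [retr₃, if_neg (not_le.2 hz)]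

/-- **`retr₃` fixes the discs `D_i`.** [cite: MilnorHCobordism1965, proof of Thm. 3.14 (PDF p. 20)] -/
theorem retr₃_eq_self_of_mem_cylDisc (H : h.ThirdRetractionHyp a ψ) {i : ι} {z : c.W} (hz : z ∈ (D i).cylDisc r)
    {t : ℝ} (ht : t ∈ Icc (0 : ℝ) 1) : h.retr₃ a ψ t z = z := by
  have hfa' : a' ≤ f z := by
    have := (MilnorBox.apply_mem_Icc_of_mem_cylDisc hz).1
    rwa [h.apply_ctr i, ← h.a'_eq] at this
  rcases eq_or_lt_of_le hfa' with heq | hlt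
  · -- on `V`: the point is on the left-hand sphere, the tube map fixes it
    have hzI : f z ∈ Icc a a' := by rw [← heq]; exact ⟨H.lt.le, le_rfl⟩
    have htop : ψ z a' = z := by rw [heq, H.levelFlow.eq_self z hzI]
    have hbase : z ∈ (D i).cylBase r η := by
      rw [MilnorBox.mem_cylBase_iff_apply, h.apply_ctr i, ← h.a'_eq]
      exact ⟨MilnorBox.cylDisc_subset_cyl hz, heq.symm⟩
    rw [h.retr₃_eq_tubeMap hzI (htop.symm ▸ hbase) t]
    exact h.tubeMap_eq_self_of_mem_stableSet H hzI (h.mem_stableSet_of_mem_cylDisc hz) (htop.symm ▸ hbase) ht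
  · exact h.retr₃_eq_self_of_lt hlt t

/-! #### Continuity of the tube map and of the vertical push -/

/-- **The tube map is jointly continuous on its piece** `[0, 1] × {z ∈ f⁻¹[a, a'] : ψ z a' ∈ V ∩ C_i}`
(at the points whose top projection is on the left-hand sphere the factor `newRad/ρ` is
discontinuous but bounded, and `y⃗ → 0`). [folklore] -/
theorem continuousOn_tubeMap (H : h.ThirdRetractionHyp a ψ) (i : ι) :
    ContinuousOn (fun p : ℝ × c.W => h.tubeMap a ψ i p.1 p.2)
      (Icc (0 : ℝ) 1 ×ˢ {z | f z ∈ Icc a a' ∧ ψ z a' ∈ (D i).cylBase r η}) := by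
  set A : Set (ℝ × c.W) := Icc (0 : ℝ) 1 ×ˢ {z | f z ∈ Icc a a' ∧ ψ z a' ∈ (D i).cylBase r η} with hA
  have hψc := H.levelFlow.continuousOn
  -- top projection, height, coordinates, radius
  have htop : ContinuousOn (fun p : ℝ × c.W => ψ p.2 a') A :=
    hψc.comp (continuousOn_snd.prodMk continuousOn_const) fun p hp => ⟨hp.2.1, H.lt.le, le_rfl⟩
  have hhgt : Continuous fun p : ℝ × c.W => h.hgt a p.2 := by
    simp only [hgt]; exact ((h.continuous_f.comp continuous_snd).sub continuous_const).div_const _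
  have hcoord : ContinuousOn (fun p : ℝ × c.W => (D i).coord (ψ p.2 a')) A :=
    (D i).continuousOn_coord.comp htop fun p hp => hp.2.2.1.1
  have hBc : ContinuousOn (fun p : ℝ × c.W => sqSumGE (D i).k ((D i).coord (ψ p.2 a'))) A :=
    (continuous_sqSumGE _).comp_continuousOn hcoord
  have hrad : ContinuousOn (fun p : ℝ × c.W => h.rad i (ψ p.2 a')) A := by
    simp only [rad]; exact (Real.continuous_sqrt.comp_continuousOn hBc).div_const _
  -- new radius and new height
  have hnR : ContinuousOn (fun p : ℝ × c.W => newRad p.1 (h.rad i (ψ p.2 a')) (h.hgt a p.2)) A := by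
    simp only [newRad]
    exact ((continuous_const.sub continuous_fst).continuousOn.mul hrad).add
      (continuousOn_fst.mul (continuous_sqRetr₁.comp_continuousOn (hrad.prodMk hhgt.continuousOn)))
  have hnH : ContinuousOn (fun p : ℝ × c.W => newHgt p.1 (h.rad i (ψ p.2 a')) (h.hgt a p.2)) A := by
    simp only [newHgt]
    exact ((continuous_const.sub continuous_fst).mul hhgt).continuousOn.add
      (continuousOn_fst.mul (continuous_sqRetr₂.comp_continuousOn (hrad.prodMk hhgt.continuousOn)))
  -- the scaled expanding part
  have hge : ContinuousOn (fun p : ℝ × c.W => gePart (D i).k ((D i).coord (ψ p.2 a'))) A :=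
    (continuous_gePart _).comp_continuousOn hcoord
  have hy : ContinuousOn (fun p : ℝ × c.W =>
      (newRad p.1 (h.rad i (ψ p.2 a')) (h.hgt a p.2) / h.rad i (ψ p.2 a')) •
        gePart (D i).k ((D i).coord (ψ p.2 a'))) A := by
    intro p hp
    by_cases hB0 : sqSumGE (D i).k ((D i).coord (ψ p.2 a')) = 0
    · refine continuousWithinAt_smul_of_norm_le (C := 1) (hge p hp) (gePart_eq_zero_of_sqSumGE_eq_zero hB0) ?_
      filter_upwards [self_mem_nhdsWithin] with q hq
      exact h.abs_yFactor_le hq.2.2 hq.1 (h.hgt_mem H.lt hq.2.1).1.1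
    · have hρ0 : h.rad i (ψ p.2 a') ≠ 0 := fun h0 => hB0 ((h.rad_eq_zero_iff hp.2.2).1 h0)
      exact ((hnR p hp).div (hrad p hp) hρ0).smul (hge p hp)
  -- the new base point and the new level
  set Y : ℝ × c.W → EuclideanSpace ℝ (Fin (n + 1)) := fun p =>
    (newRad p.1 (h.rad i (ψ p.2 a')) (h.hgt a p.2) / h.rad i (ψ p.2 a')) •
      gePart (D i).k ((D i).coord (ψ p.2 a')) with hY
  set Bp : ℝ × c.W → c.W := fun p => (D i).basePt r (ψ p.2 a') (Y p) with hBp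
  set Lv : ℝ × c.W → ℝ := fun p => a + newHgt p.1 (h.rad i (ψ p.2 a')) (h.hgt a p.2) * (a' - a) with hLv
  have hbase : ContinuousOn Bp A := by
    have := ContinuousOn.comp (g := fun q : c.W × EuclideanSpace ℝ (Fin (n + 1)) => (D i).basePt r q.1 q.2)
      (f := fun p : ℝ × c.W => (ψ p.2 a', Y p)) (MilnorBox.continuousOn_basePt (h.sq_le i) h.r_pos)
      (htop.prodMk hy) fun p hp => ⟨hp.2.2, (h.sqSumGE_yvec hp.2.2 hp.1 (h.hgt_mem H.lt hp.2.1).1.1).2.2⟩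
    exact this
  have hlev : ContinuousOn Lv A := continuousOn_const.add (hnH.mul continuousOn_const)
  have hfin := ContinuousOn.comp (g := fun q : c.W × ℝ => ψ q.1 q.2) (f := fun p : ℝ × c.W => (Bp p, Lv p))
    hψc (hbase.prodMk hlev) fun p hp => ⟨?_, ?_⟩
  · exact hfin.congr fun p hp => rfl
  · show f (Bp p) ∈ Icc a a'
    rw [hBp, (h.basePt_yvec_mem hp.2.2 hp.1 (h.hgt_mem H.lt hp.2.1).1.1).2.2]; exact ⟨H.lt.le, le_rfl⟩
  · exact h.tube_level_mem H hp.2.1 hp.1 (h.rad_mem hp.2.2).1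

/-- The vertical push is jointly continuous on `[0, 1] × f⁻¹[a, a']`. [folklore] -/
theorem continuousOn_vertMap (H : h.ThirdRetractionHyp a ψ) :
    ContinuousOn (fun p : ℝ × c.W => h.vertMap a ψ p.1 p.2) (Icc (0 : ℝ) 1 ×ˢ (f ⁻¹' Icc a a')) := by
  have hin : Continuous fun p : ℝ × c.W => (p.2, a + (1 - p.1) * (f p.2 - a)) := by
    have := h.continuous_f; fun_prop
  exact H.levelFlow.continuousOn.comp hin.continuousOn fun p hp => ⟨hp.2, vert_level_mem (a' := a') hp.2 hp.1⟩

/-! #### Stage 3, packaged -/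

/-- **Stage 3 of the strong deformation retraction** (the part of Milnor's construction below
the box, done in the product structure of `f⁻¹[a, a']`): the maps `retr₃ t` form a homotopy of
`f⁻¹[a, a'] ∪ ⋃ D_i` in itself, jointly continuous on `[0, 1] × (f⁻¹[a, a'] ∪ ⋃ D_i)`, from the
identity to a map into `f⁻¹(a) ∪ ⋃ D_L(ctr i)` (left-hand discs down to the level `a`), fixing
that set pointwise. [cite: MilnorHCobordism1965, proof of Thm. 3.14 (PDF pp. 19–20), with Def. 3.9 (PDF p. 16) and Thm. 3.4 (PDF p. 12)] -/
theorem retr₃_spec [Finite ι] (H : h.ThirdRetractionHyp a ψ) :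
    ContinuousOn (fun p : ℝ × c.W => h.retr₃ a ψ p.1 p.2)
        (Icc (0 : ℝ) 1 ×ˢ (f ⁻¹' Icc a a' ∪ ⋃ i, (D i).cylDisc r)) ∧
      (∀ t ∈ Icc (0 : ℝ) 1, MapsTo (h.retr₃ a ψ t) (f ⁻¹' Icc a a' ∪ ⋃ i, (D i).cylDisc r)
        (f ⁻¹' Icc a a' ∪ ⋃ i, (D i).cylDisc r)) ∧
      (∀ z ∈ f ⁻¹' Icc a a' ∪ ⋃ i, (D i).cylDisc r, h.retr₃ a ψ 0 z = z) ∧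
      (∀ z ∈ f ⁻¹' Icc a a' ∪ ⋃ i, (D i).cylDisc r,
        h.retr₃ a ψ 1 z ∈ f ⁻¹' {a} ∪ ⋃ i, leftHandDisc (𝓡∂ (n + 1)) f ξ (ctr i) a) ∧
      (∀ t ∈ Icc (0 : ℝ) 1, ∀ z ∈ f ⁻¹' Icc a a' ∪ ⋃ i, (D i).cylDisc r,
        z ∈ (f ⁻¹' {a} ∪ ⋃ i, leftHandDisc (𝓡∂ (n + 1)) f ξ (ctr i) a) → h.retr₃ a ψ t z = z) := by
  have h0I : (0 : ℝ) ∈ Icc (0 : ℝ) 1 := ⟨le_rfl, zero_le_one⟩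
  have h1I : (1 : ℝ) ∈ Icc (0 : ℝ) 1 := ⟨zero_le_one, le_rfl⟩
  refine ⟨?_, ?_, ?_, ?_, ?_⟩
  · ------------------------------------------------------------------------------------------
    -- continuity: paste the tube pieces, the vertical piece and the disc piece
    ------------------------------------------------------------------------------------------
    set L : Set c.W := f ⁻¹' Icc a a' with hL
    set O : Set c.W := ⋃ i, {w | w ∈ (D i).chart.source ∧ sqSumGE (D i).k ((D i).coord w) < η ^ 2} with hO
    have hLc : IsClosed L := isClosed_Icc.preimage h.continuous_f
    have hOo : IsOpen O := isOpen_iUnion fun i =>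
      (D i).continuousOn_sqSum_coord.2.isOpen_inter_preimage (D i).chart.open_source isOpen_Iio
    have hg : ContinuousOn (fun z => ψ z a') L :=
      H.levelFlow.continuousOn.comp (continuousOn_id.prodMk continuousOn_const) fun z hz => ⟨hz, H.lt.le, le_rfl⟩
    set P : Option (Option ι) → Set (ℝ × c.W) := fun o => Option.elim o
      (Icc (0 : ℝ) 1 ×ˢ (L ∩ (fun z => ψ z a') ⁻¹' Oᶜ)) fun o' => Option.elim o'
        (Icc (0 : ℝ) 1 ×ˢ ⋃ i, (D i).cylDisc r)
        fun i => Icc (0 : ℝ) 1 ×ˢ (L ∩ (fun z => ψ z a') ⁻¹' (D i).cylBase r η) with hP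
    have hcover : Icc (0 : ℝ) 1 ×ˢ (L ∪ ⋃ i, (D i).cylDisc r) = ⋃ o, P o := by
      ext ⟨t, z⟩
      simp only [mem_prod, mem_union, mem_iUnion, hP]
      constructor
      · rintro ⟨ht, hz | ⟨i, hi⟩⟩
        · rcases h.exists_mem_cylBase_or H hz with ⟨i, hi⟩ | hvert
          · exact ⟨some (some i), ht, hz, hi⟩
          · refine ⟨none, ht, hz, ?_⟩
            show ψ z a' ∉ O
            simp only [hO, mem_iUnion, mem_setOf_eq, not_exists, not_and, not_lt]
            exact hvert
        · exact ⟨some none, ht, mem_iUnion.2 ⟨i, hi⟩⟩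
      · rintro ⟨_ | _ | i, hmem⟩
        · exact ⟨hmem.1, Or.inl hmem.2.1⟩
        · exact ⟨hmem.1, Or.inr (mem_iUnion.1 hmem.2)⟩
        · exact ⟨hmem.1, Or.inl hmem.2.1⟩
    rw [hcover]
    refine LocallyFinite.continuousOn_iUnion (locallyFinite_of_finite P) (fun o => ?_) fun o => ?_
    · rcases o with _ | _ | i
      · exact isClosed_Icc.prod (hg.preimage_isClosed_of_isClosed hLc hOo.isClosed_compl)
      · exact isClosed_Icc.prod (isClosed_iUnion_of_finite fun i =>
          MilnorBox.isClosed_cylDisc (by nlinarith [h.sq_le i, h.η_pos]))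
      · exact isClosed_Icc.prod (hg.preimage_isClosed_of_isClosed hLc (MilnorBox.isClosed_cylBase (h.sq_le i)))
    · rcases o with _ | _ | i
      · refine ((h.continuousOn_vertMap H).mono fun p hp => ⟨hp.1, hp.2.1⟩).congr fun p hp => ?_
        refine h.retr₃_eq_vertMap H hp.2.1 (fun i hsrc => ?_) hp.1
        have hnot : ψ p.2 a' ∉ O := hp.2.2
        simp only [hO, mem_iUnion, mem_setOf_eq, not_exists, not_and, not_lt] at hnot
        exact hnot i hsrc
      · refine continuousOn_snd.congr fun p hp => ?_
        obtain ⟨i, hi⟩ := mem_iUnion.1 hp.2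
        exact h.retr₃_eq_self_of_mem_cylDisc H hi hp.1
      · exact (h.continuousOn_tubeMap H i).congr fun p hp => h.retr₃_eq_tubeMap hp.2.1 hp.2.2 p.1
  · ------------------------------------------------------------------------------------------
    -- maps the set into itself
    ------------------------------------------------------------------------------------------
    intro t ht z hz
    rcases hz with hz | hz
    · left
      rcases h.exists_mem_cylBase_or H hz with ⟨i, hi⟩ | hvert
      · rw [h.retr₃_eq_tubeMap hz hi t]; exact (h.apply_tubeMap H hz hi ht).2
      · rw [h.retr₃_eq_vertMap H hz hvert ht]; exact (h.apply_vertMap H hz ht).2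
    · obtain ⟨i, hi⟩ := mem_iUnion.1 hz
      rw [h.retr₃_eq_self_of_mem_cylDisc H hi ht]; exact Or.inr hz
  · ------------------------------------------------------------------------------------------
    -- `t = 0`
    ------------------------------------------------------------------------------------------
    intro z hz
    rcases hz with hz | hz
    · rcases h.exists_mem_cylBase_or H hz with ⟨i, hi⟩ | hvert
      · rw [h.retr₃_eq_tubeMap hz hi 0]; exact h.tubeMap_zero H hz hi
      · rw [h.retr₃_eq_vertMap H hz hvert h0I]; exact h.vertMap_zero H hz
    · obtain ⟨i, hi⟩ := mem_iUnion.1 hz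
      exact h.retr₃_eq_self_of_mem_cylDisc H hi h0I
  · ------------------------------------------------------------------------------------------
    -- `t = 1`
    ------------------------------------------------------------------------------------------
    intro z hz
    rcases hz with hz | hz
    · rcases h.exists_mem_cylBase_or H hz with ⟨i, hi⟩ | hvert
      · rw [h.retr₃_eq_tubeMap hz hi 1]
        rcases h.tubeMap_one_mem H hz hi with h1 | h1
        · exact Or.inl h1
        · exact Or.inr (mem_iUnion.2 ⟨i, h1⟩)
      · rw [h.retr₃_eq_vertMap H hz hvert h1I]; exact Or.inl (h.vertMap_one H hz)
    · obtain ⟨i, hi⟩ := mem_iUnion.1 hz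
      rw [h.retr₃_eq_self_of_mem_cylDisc H hi h1I]
      right
      refine mem_iUnion.2 ⟨i, h.mem_stableSet_of_mem_cylDisc hi, ?_⟩
      have := (MilnorBox.apply_mem_Icc_of_mem_cylDisc hi).1
      rw [h.apply_ctr i, ← h.a'_eq] at this
      exact H.lt.le.trans this
  · ------------------------------------------------------------------------------------------
    -- fixes the target
    ------------------------------------------------------------------------------------------
    intro t ht z hz hzB
    rcases hz with hz | hz
    · rcases hzB with hza | hzD
      · have hza' : f z = a := hza
        rcases h.exists_mem_cylBase_or H hz with ⟨i, hi⟩ | hvert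
        · rw [h.retr₃_eq_tubeMap hz hi t]; exact h.tubeMap_eq_self_of_apply_eq H hza' hi ht
        · rw [h.retr₃_eq_vertMap H hz hvert ht]; exact h.vertMap_eq_self_of_apply_eq H hza' t
      · obtain ⟨i, hi⟩ := mem_iUnion.1 hzD
        -- the top projection lies on the left-hand sphere of `ctr i`: tube branch
        have hwst : ψ z a' ∈ stableSet (𝓡∂ (n + 1)) ξ (ctr i) :=
          (H.levelFlow.flowsTo_of_ge z hz a' ⟨H.lt.le, le_rfl⟩ hz.2).mem_stableSet_right h.slab.contMDiff_one hi.1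
        have hsph : ψ z a' ∈ leftHandSphere (𝓡∂ (n + 1)) f ξ (ctr i) a' := ⟨hwst, h.apply_top H hz⟩
        rw [h.mem_leftHandSphere_ctr_iff] at hsph
        rw [h.retr₃_eq_tubeMap hz hsph.1 t]
        exact h.tubeMap_eq_self_of_mem_stableSet H hz hi.1 hsph.1 ht
    · obtain ⟨i, hi⟩ := mem_iUnion.1 hz
      exact h.retr₃_eq_self_of_mem_cylDisc H hi ht

end Assembly

end FirstRetractionSetting

end Cobordism

end ThirdRetraction

end Literature.Topology.FourManifolds
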